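import Literature.MathematicalPhysics.QuantumFieldTheory.Balaban1983to89.B9SectBQVariationY
import Literature.MathematicalPhysics.QuantumFieldTheory.Balaban1983to89.B9SectBGFrameV5
import Literature.MathematicalPhysics.QuantumFieldTheory.Balaban1983to89.Node00.OpsYRead342CrossB
import Literature.MathematicalPhysics.QuantumFieldTheory.Balaban1983to89.B9Thm31SiteCurvatureCommutatorsY

/-!
# Balaban [B9], Thm 3.4 p. 400, Thm 3.3 p. 399, (3.26)–(3.27) p. 395, (3.42) p. 397, (3.80)–(3.86) p. 407 — ★★★ THE G FRAME OF ROW 13 INSTANTIATED AT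
# NODE 00's LETTERS: `gFrame₅CodedOn : GFrame₅ …` over the coded carriers of a subfamily for the bond family
# `KACU G x (GAY parS parB (GpY parS)) parB C37 C38` (pub-ymgap N06 G-side plan, Route L, L-5c), and its (3.42) step ★★ `stepEPos_KACU_frame_on`

T. Bałaban, *Propagators for lattice gauge theories in a background field*, Commun. Math. Phys. **99** (1985) 389–434
[`Balaban1985BackgroundPropagators`, "B9"]; [4] = T. Bałaban, *Propagators and renormalization transformations for lattice gauge
theories. II*, Commun. Math. Phys. **96** (1984) 223–250 [`Balaban1984PropagatorsII`].

statement-level skeleton of published theorems with citation tags; proofs where landed; nothing here is a claim about the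
Yang–Mills mass gap

WHY THIS FILE (seat dag-n06-c gen 13).  r06's Sect.-B chain for the bond sector is the hypothesis frame `GFrame₅` (V5: `B9SectBGFrameV5`, the inhabitable head
after LOCATED-12∕13) over gen 12's `CinvFrame₃` instance `B9SectBKerFrameCodedY.cinvFrame₃CodedOn`.  THIS FILE inhabits its 40 further fields at NODE 00's
letters, each by a landed∕typed lemma of gen 12–13: letters `GbC ∕ QbC ∕ QsbC ∕ abC ∕ F₂C ∕ F₂sC ∕ LapBC` and the laws `reg_ginv` ∕ `gb_eq_cplx` ∕ `qb_mul`
(`B9SectBGWordDeltaAY` — DESIGN POINT 2: `Δ_a(U)` IS the frame's word), `hQb ∕ hQsb ∕ ha324 ∕ hF₂` (`B9SectBQSizesY`, print's split of the block volume),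
structure + stencils (`B9SectBGClassLettersY`, `B9SectBKerLettersY.repY`), `readG342 ∕ writeG342` (`B9SectBGReadCodedY`: gen 12's dictionaries transported);
DISPLAYED beyond the parent's binders, all print-intrinsic and each with a record-level discharge route (header of `B9SectBGClassLettersY`): `hunitA` (Thm 3.1:
`Δ_a(U)` invertible at G-valued bases), `hparB` (the averaging transporters take values in `G`), `hb₁` (`0 ≤ b₁`), `hreg335P` ((3.35) on plaquettes),
`hC37G` (the seven (3.37) letter bounds), `hvarB` (the (3.80)–(3.81) transporter variation), `hMd : 2(d+1) < MInv` and a neighbour count `m_N` (`hnbr`) — the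
CROSS (3.42) read entries `∇*·G`, `G·∇` are DISCHARGED from node00-def-Y's `OpsYRead342CrossB` (★★ `crossReadY_KACU`, rate-dependent constant `cXY δ`, LOCATED-13).  §3: the (3.42) step `StepEPos` of the coded bond family by `stepEPos_of_gFrame₅`.

HONEST SCOPE.  An instance of a hypothesis frame at defined letters + one conditional step theorem; the displayed laws are hypotheses, not discharged here;
nothing of [B9]'s analysis asserted beyond r06's landed clauses; count-neutral; N06 NOT discharged; nothing continuum ∕ OS ∕ mass-gap ∕ Clay.  No `sorry`, no
`axiom`, no `instance`, no `notation`; one `def … : Prop` with parameters (`CrossReadY`, a named hypothesis).  `--supports stmt-QuantumFields-27364`.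
-/

noncomputable section

namespace Literature.MathematicalPhysics.QuantumFieldTheory.Balaban1983to89.B9SectBGFrameCodedY

open Literature.MathematicalPhysics.QuantumFieldTheory.Balaban1983to89
open Literature.MathematicalPhysics.QuantumFieldTheory.Balaban1983to89.Node00 (SiteY BlkY FBondY IBondY CfgY SiteParY BondOpY BondParY UboxY shiftY GpY GAY XY
  deltaAY deltaPrimeAY bondCoordsY bondFunCoordsY)
open Literature.MathematicalPhysics.QuantumFieldTheory.Balaban1983to89.B6Ineq2142KLevelV1 (β)
open Literature.MathematicalPhysics.QuantumFieldTheory.Balaban1983to89.B6KLevelCensusIndexV1 (KIdx kGeo)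
open Literature.MathematicalPhysics.QuantumFieldTheory.Balaban1983to89.B6RandomWalk (HasMajorant hasMajorant_mono Ineq261)
open Literature.MathematicalPhysics.QuantumFieldTheory.Balaban1983to89.B9Thm34Ext (toB6)
open Literature.MathematicalPhysics.QuantumFieldTheory.Balaban1983to89.B9FromB6 (EBlock)
open Literature.MathematicalPhysics.QuantumFieldTheory.Balaban1983to89.B9GeoNormsKLevelV1 (geo9K geo9K_dist_nonneg)
open Literature.MathematicalPhysics.QuantumFieldTheory.Balaban1983to89.B9Eq39Adjoint (covD covDstar prodCfg plaqU)
open Literature.MathematicalPhysics.QuantumFieldTheory.Balaban1983to89.B9Eq352DivFormLetters (conj)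
open Literature.MathematicalPhysics.QuantumFieldTheory.Balaban1983to89.B9Eq352GradLetters (diffLetter)
open Literature.MathematicalPhysics.QuantumFieldTheory.Balaban1983to89.B9Eq371GradLetters (bT bU)
open Literature.MathematicalPhysics.QuantumFieldTheory.Balaban1983to89.B9Eq372RemLetters (lapDDLetter)
open Literature.MathematicalPhysics.QuantumFieldTheory.Balaban1983to89.B9Eq382V3Letters (dPrimeLetter)
open Literature.MathematicalPhysics.QuantumFieldTheory.Balaban1983to89.B9Eq376POneLetters (conjHom gradLin divLin)
open Literature.MathematicalPhysics.QuantumFieldTheory.Balaban1983to89.B9Eq386Neumann (deltaA)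
open Literature.MathematicalPhysics.QuantumFieldTheory.Balaban1983to89.B9Eq360DeltaPrimeAY (AfldY)
open Literature.MathematicalPhysics.QuantumFieldTheory.Balaban1983to89.B9PinMembersKLevelV1 (MemberY geo9Y bg9Y)
open Literature.MathematicalPhysics.QuantumFieldTheory.Balaban1983to89.B9SectBGpLettersY (decY decY_base decY_prod GVal blkC coordC expAC GopC norm_le_one_and_inv_of_mem)
open Literature.MathematicalPhysics.QuantumFieldTheory.Balaban1983to89.B9SectBL2DictionaryY (coordC_base_eq)
open Literature.MathematicalPhysics.QuantumFieldTheory.Balaban1983to89.B9SectBKerLettersY (QcC QcsC CopC repY blkC_repY repY_injective)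
open Literature.MathematicalPhysics.QuantumFieldTheory.Balaban1983to89.B9SectBGpFrameCodedY (codingYx CplxLettersY)
open Literature.MathematicalPhysics.QuantumFieldTheory.Balaban1983to89.B9SectBKerFrameCodedY (cinvFrame₃CodedOn CinvY)
open Literature.MathematicalPhysics.QuantumFieldTheory.Balaban1983to89.B9SectBCodedCarrier (CCfg pullS)
open Literature.MathematicalPhysics.QuantumFieldTheory.Balaban1983to89.B9SectBCodedReadingsU (KACU)
open Literature.MathematicalPhysics.QuantumFieldTheory.Balaban1983to89.B9SectBGpReadingsY (KSC)
open Literature.MathematicalPhysics.QuantumFieldTheory.Balaban1983to89.B9SectBGpTransferInY (eBlock_mono)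
open Literature.MathematicalPhysics.QuantumFieldTheory.Balaban1983to89.B9SectBStepWhole (StepEPos)
open Literature.MathematicalPhysics.QuantumFieldTheory.Balaban1983to89.B9SectBGFrameV5 (GFrame₅ stepEPos_of_gFrame₅)
open Literature.MathematicalPhysics.QuantumFieldTheory.Balaban1983to89.B9SectBGWordDeltaAY (GbC QbC QsbC abC F₂C F₂sC LapBC word_mul_GbC GbC_eq_of_two_sided
  qbC_prod qsbC_prod)
open Literature.MathematicalPhysics.QuantumFieldTheory.Balaban1983to89.B9SectBGReadCodedY (eta_inv_eq_abs_cf hasMajorant_of_eq readG342_GbC_printed writeG342_GbC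
  GbC_eq_conj_bondOpCoordsRY hasMajorant_diffLetter_inr_mul hasMajorant_mul_diffLetter_inl)
open Literature.MathematicalPhysics.QuantumFieldTheory.Balaban1983to89.B9RWSumsReadsNbr (nbr)
open Literature.MathematicalPhysics.QuantumFieldTheory.Balaban1983to89.B9SectBGReadY (eBlock_kernelFamilyB_of_KACU_base)
open Literature.MathematicalPhysics.QuantumFieldTheory.Balaban1983to89.Node00.OpsYRead342CrossB (hasMajorant_conj_cdsB_O_of_eBlockB hasMajorant_conj_O_cdB_of_eBlockB)
open Literature.MathematicalPhysics.QuantumFieldTheory.Balaban1983to89.B9SectBGClassLettersY (stencilFB_blkC stencilSt_blkC stencilLoc_blkC Reg335PlaqY CplxLettersGY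
  VarParBY)
open Literature.MathematicalPhysics.QuantumFieldTheory.Balaban1983to89.B9GeoLemma21KLevelV1 (geo9K_one_le_L)
open Literature.MathematicalPhysics.QuantumFieldTheory.Balaban1983to89.B9Thm31SiteCurvatureCommutatorsY (shiftY_shiftY_comm)
open Literature.MathematicalPhysics.QuantumFieldTheory.Balaban1983to89.B9SectBQSizesY (hasMajorant_QbC hasMajorant_QsbC hasMajorant_abC)
open Literature.MathematicalPhysics.QuantumFieldTheory.Balaban1983to89.B9SectBQVariationY (hasMajorant_F₂C hasMajorant_F₂sC)

variable {d ℓ : ℕ} {hd : 1 ≤ d + 1} {hL : Odd (ℓ + 1) ∧ 1 < ℓ + 1} {b₀ b₁ : ℝ} {Mstar : ℕ}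
variable {𝔸 : Type} [NormedRing 𝔸] [NormedAlgebra ℂ 𝔸] [CompleteSpace 𝔸]

/-! ## §1 The displayed cross-entry law and field-shaped readings at one member -/

section Prep

variable (G : Subgroup 𝔸ˣ) (x : MemberY d ℓ hd hL b₀ b₁ Mstar) (parS : SiteParY 𝔸 x.toKIdx) (parB : BondParY 𝔸 x.toKIdx) {ι : Type} [Fintype ι]
  (b : Module.Basis ι ℝ 𝔸) (ιB : BlkY x.toKIdx → IBondY x.toKIdx) (C37 C38 : ℝ → CfgY 𝔸 x.toKIdx → AfldY 𝔸 x.toKIdx → Prop)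
  [Fintype (geo9Y x).Site] {Rr : ℝ} {Hp : Prop}

/-- **THE CROSS (3.42) READ ENTRIES AS A NAMED LAW** (rate-dependent constant `cX δ`): at a `G`-valued base the (3.42) block of the coded bond family with
`(B₀, δ)` gives block majorants `cX δ·B₀·ℓ(a)·e^{−δd}` of the LEFT-BACKWARD products `conj b (diffLetter … (inr ν)) * GbC` and the RIGHT-FORWARD products
`GbC * conj b (diffLetter … (inl ν))` — the entries print's (3.42) does not list (p.398 l.20–22 licence); node00-def-Y's `OpsYRead342CrossB` supplies it with
`cX δ = O(1)·L·e^{2(d+1)δ}` (LOCATED-13). [cite: Balaban1985BackgroundPropagators, (3.42) p.397, p.398 l.20–22, (3.8) p.392] -/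
def CrossReadY (cX : ℝ → ℝ) : Prop :=
  ∀ (U : CfgY 𝔸 x.toKIdx) (B₀ δ : ℝ), 2 * ((d : ℝ) + 1) < (geo9Y x).M → GVal G x.toKIdx U → 0 ≤ B₀ → 0 < δ →
    EBlock (KACU G x (GAY x.toKIdx parS parB (GpY x.toKIdx parS)) parB C37 C38) B₀ δ (.base U) →
    (∀ ν : Fin (d + 1), HasMajorant (g := toB6 (geo9Y x) Rr Hp) (fun q : (Fin (d + 1) × SiteY x.toKIdx) × ι => blkC x.toKIdx ιB q.1.2)
        (conj b (diffLetter (bT (shiftY x.toKIdx)) (bU (coordC G x.toKIdx (.base U))) ((((geo9Y x).eta : ℂ))⁻¹) (Sum.inr ν)) *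
          GbC x.toKIdx parS parB b (.base U))
        (fun a a' => cX δ * B₀ * (geo9Y x).len a * Real.exp (-(δ * (geo9Y x).dist a a')))) ∧
    (∀ ν : Fin (d + 1), HasMajorant (g := toB6 (geo9Y x) Rr Hp) (fun q : (Fin (d + 1) × SiteY x.toKIdx) × ι => blkC x.toKIdx ιB q.1.2)
        (GbC x.toKIdx parS parB b (.base U) *
          conj b (diffLetter (bT (shiftY x.toKIdx)) (bU (coordC G x.toKIdx (.base U))) ((((geo9Y x).eta : ℂ))⁻¹) (Sum.inl ν)))
        (fun a a' => cX δ * B₀ * (geo9Y x).len a * Real.exp (-(δ * (geo9Y x).dist a a'))))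

/-- ★ FIELD `readG342` AT ONE MEMBER: print's four entries (`readG342_GbC_printed`, constant `M₂Σ_j‖b_j‖`) and the cross entries (`CrossReadY`, constant `cX δ`)
under the common constant `M₂Σ_j‖b_j‖ + cX δ`. [cite: Balaban1985BackgroundPropagators, Thm 3.3 p.399 with (3.42) p.397; Balaban1984PropagatorsII, (2.51) p.232] -/
theorem readG342_base (hι : ∀ s, β x.toKIdx.hN x.toKIdx.D x.toKIdx.hk (ιB s) = s) {M₂ : ℝ} (hM₂ : 0 ≤ M₂)
    (hrepr : ∀ (v : 𝔸) (j : ι), |b.repr v j| ≤ M₂ * ‖v‖) {cX : ℝ → ℝ} (hcX : ∀ δ, 0 < δ → 0 ≤ cX δ)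
    (hcross : CrossReadY (Rr := Rr) (Hp := Hp) G x parS parB b ιB C37 C38 cX) (hdM : 2 * ((d : ℝ) + 1) < (geo9Y x).M) (U : CfgY 𝔸 x.toKIdx)
    (hUG : GVal G x.toKIdx U) {B₀ δ : ℝ} (hB₀ : 0 < B₀) (hδ : 0 < δ)
    (hE : EBlock (KACU G x (GAY x.toKIdx parS parB (GpY x.toKIdx parS)) parB C37 C38) B₀ δ (.base U)) :
    HasMajorant (g := toB6 (geo9Y x) Rr Hp) (fun q : (Fin (d + 1) × SiteY x.toKIdx) × ι => blkC x.toKIdx ιB q.1.2) (GbC x.toKIdx parS parB b (.base U))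
        (fun a a' => (M₂ * (∑ j, ‖b j‖) + cX δ) * B₀ * (geo9Y x).len a ^ 2 * Real.exp (-(δ * (geo9Y x).dist a a'))) ∧
      (∀ k : Fin (d + 1) ⊕ Fin (d + 1), HasMajorant (g := toB6 (geo9Y x) Rr Hp) (fun q : (Fin (d + 1) × SiteY x.toKIdx) × ι => blkC x.toKIdx ιB q.1.2)
        (conj b (diffLetter (bT (shiftY x.toKIdx)) (bU (coordC G x.toKIdx (.base U))) ((((geo9Y x).eta : ℂ))⁻¹) k) * GbC x.toKIdx parS parB b (.base U))
        (fun a a' => (M₂ * (∑ j, ‖b j‖) + cX δ) * B₀ * (geo9Y x).len a * Real.exp (-(δ * (geo9Y x).dist a a')))) ∧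
      (∀ k : Fin (d + 1) ⊕ Fin (d + 1), HasMajorant (g := toB6 (geo9Y x) Rr Hp) (fun q : (Fin (d + 1) × SiteY x.toKIdx) × ι => blkC x.toKIdx ιB q.1.2)
        (GbC x.toKIdx parS parB b (.base U) * conj b (diffLetter (bT (shiftY x.toKIdx)) (bU (coordC G x.toKIdx (.base U))) ((((geo9Y x).eta : ℂ))⁻¹) k))
        (fun a a' => (M₂ * (∑ j, ‖b j‖) + cX δ) * B₀ * (geo9Y x).len a * Real.exp (-(δ * (geo9Y x).dist a a')))) ∧
      HasMajorant (g := toB6 (geo9Y x) Rr Hp) (fun q : (Fin (d + 1) × SiteY x.toKIdx) × ι => blkC x.toKIdx ιB q.1.2)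
        (LapBC x.toKIdx b (.base U) * GbC x.toKIdx parS parB b (.base U))
        (fun a a' => (M₂ * (∑ j, ‖b j‖) + cX δ) * B₀ * 1 * Real.exp (-(δ * (geo9Y x).dist a a'))) := by
  obtain ⟨h0, h1, h2, h3⟩ := readG342_GbC_printed (Rr := Rr) (Hp := Hp) G x parS parB b ιB C37 C38 hι hM₂ hrepr U hUG hB₀.le hE
  obtain ⟨c1, c2⟩ := hcross U B₀ δ hdM hUG hB₀.le hδ hE
  have hMS : 0 ≤ M₂ * ∑ j, ‖b j‖ := mul_nonneg hM₂ (Finset.sum_nonneg fun j _ => norm_nonneg _)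
  have hcx := hcX δ hδ
  have hlen : ∀ a : (geo9Y x).Site, 0 ≤ (geo9Y x).len a := fun a => (B9GeoLemma21KLevelV1.geo9Y_len_pos x a).le
  have up1 : ∀ (w : (geo9Y x).Site → ℝ), (∀ a, 0 ≤ w a) → ∀ a a' : (geo9Y x).Site,
      M₂ * (∑ j, ‖b j‖) * B₀ * w a * Real.exp (-(δ * (geo9Y x).dist a a')) ≤
        (M₂ * (∑ j, ‖b j‖) + cX δ) * B₀ * w a * Real.exp (-(δ * (geo9Y x).dist a a')) := fun w hw a a' => by
    have : 0 ≤ B₀ * w a * Real.exp (-(δ * (geo9Y x).dist a a')) := mul_nonneg (mul_nonneg hB₀.le (hw a)) (Real.exp_pos _).le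
    nlinarith
  have up2 : ∀ (w : (geo9Y x).Site → ℝ), (∀ a, 0 ≤ w a) → ∀ a a' : (geo9Y x).Site,
      cX δ * B₀ * w a * Real.exp (-(δ * (geo9Y x).dist a a')) ≤
        (M₂ * (∑ j, ‖b j‖) + cX δ) * B₀ * w a * Real.exp (-(δ * (geo9Y x).dist a a')) := fun w hw a a' => by
    have : 0 ≤ B₀ * w a * Real.exp (-(δ * (geo9Y x).dist a a')) := mul_nonneg (mul_nonneg hB₀.le (hw a)) (Real.exp_pos _).le
    nlinarith
  refine ⟨hasMajorant_mono _ h0 (up1 (fun a => (geo9Y x).len a ^ 2) fun a => sq_nonneg _), fun k => ?_, fun k => ?_,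
    hasMajorant_mono _ h3 (up1 (fun _ => (1 : ℝ)) fun _ => zero_le_one)⟩
  · cases k with
    | inl ν => exact hasMajorant_mono _ (h1 ν) (up1 (fun a => (geo9Y x).len a) hlen)
    | inr ν => exact hasMajorant_mono _ (c1 ν) (up2 (fun a => (geo9Y x).len a) hlen)
  · cases k with
    | inl ν => exact hasMajorant_mono _ (c2 ν) (up2 (fun a => (geo9Y x).len a) hlen)
    | inr ν => exact hasMajorant_mono _ (h2 ν) (up1 (fun a => (geo9Y x).len a) hlen)

omit [Fintype (geo9Y x).Site] in
/-- the transporters of a `G`-valued configuration are contractive with contractive inverses, given the displayed law `hparB`.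
[cite: Balaban1985BackgroundPropagators, (3.35) p.396 («U … in G»), bookkeeping] -/
theorem parB_contractive (hG1 : ∀ u : 𝔸ˣ, u ∈ G → ‖(u : 𝔸)‖ ≤ 1) {U : CfgY 𝔸 x.toKIdx} (hparBU : ∀ y f, parB U y f ∈ G) :
    ∀ s s', ‖(parB U s s' : 𝔸)‖ ≤ 1 ∧ ‖(((parB U s s')⁻¹ : 𝔸ˣ) : 𝔸)‖ ≤ 1 :=
  fun s s' => norm_le_one_and_inv_of_mem G hG1 (hparBU s s')

/-- the cross-read constant at NODE 00's letters: `cX δ = M₂Σ_j‖b_j‖·(L + m_N·M₂Σ_j‖b_j‖)·e^{2(d+1)|δ|}` (`m_N` a bound on the number of blocks within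
`2(d+1)` of a block). [cite: Balaban1985BackgroundPropagators, (3.42) p.397, p.398 l.20–22; Balaban1984PropagatorsII, (2.51) p.232] -/
def cXY (M₂ : ℝ) (mN : ℕ) (δ : ℝ) : ℝ :=
  M₂ * (∑ j, ‖b j‖) * ((((ℓ + 1 : ℕ) : ℝ)) + (mN : ℝ) * (M₂ * ∑ j, ‖b j‖)) * Real.exp (|δ| * (2 * ((d : ℝ) + 1)))

omit [CompleteSpace 𝔸] [Fintype (geo9Y x).Site] in
/-- `cX δ ≥ 0`. [cite: Balaban1985BackgroundPropagators, (3.42) p.397, bookkeeping] -/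
theorem cXY_nonneg {M₂ : ℝ} (hM₂ : 0 ≤ M₂) (mN : ℕ) (δ : ℝ) : 0 ≤ cXY (d := d) (ℓ := ℓ) b M₂ mN δ := by
  unfold cXY; positivity

/-- ★★ **THE CROSS READ LAW DISCHARGED** from node00-def-Y's bond-sector cross entries (`OpsYRead342CrossB`, FILE 63: `∇*_{V,ν}∘O(V)` and `O(V)∘∇_{V,ν}` read
from the (3.42) block with the shifted-block factor `L·e^{2(d+1)|δ|}`, resp. `m_N·M₂Σ‖b_j‖·e^{2(d+1)|δ|}`), transported to r06's carrier and letters by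
`B9SectBGReadCodedY.hasMajorant_diffLetter_inr_mul ∕ hasMajorant_mul_diffLetter_inl`; displayed: `G`-valued bond variables are contractive (`hG1`), the
neighbour count `m_N`. [cite: Balaban1985BackgroundPropagators, (3.42) p.397, p.398 l.20–22, (3.3) p.390, (3.8) p.392; Balaban1984PropagatorsII, (2.51) p.232, (2.60)–(2.61) p.234] -/
theorem crossReadY_KACU (hι : ∀ s, β x.toKIdx.hN x.toKIdx.D x.toKIdx.hk (ιB s) = s) (hG1 : ∀ u : 𝔸ˣ, u ∈ G → ‖(u : 𝔸)‖ ≤ 1) {M₂ : ℝ} (hM₂ : 0 ≤ M₂)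
    (hrepr : ∀ (v : 𝔸) (j : ι), |b.repr v j| ≤ M₂ * ‖v‖) {mN : ℕ}
    (hnbr : ∀ y' : IBondY x.toKIdx, (nbr (geo9Y x) (2 * ((d : ℝ) + 1)) y').card ≤ mN) :
    CrossReadY (Rr := Rr) (Hp := Hp) G x parS parB b ιB C37 C38 (cXY (d := d) (ℓ := ℓ) b M₂ mN) := by
  intro U B₀ δ hdM hUG hB₀ hδ hE
  letI : Fintype (geo9K x.toKIdx).Site := ‹Fintype (geo9Y x).Site›
  have hEB : EBlock (Node00.kernelFamilyB x.toKIdx (bg9Y 𝔸 G x) (fun U => U) (GAY x.toKIdx parS parB (GpY x.toKIdx parS)) parB) B₀ δ U :=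
    eBlock_kernelFamilyB_of_KACU_base G x (GAY x.toKIdx parS parB (GpY x.toKIdx parS)) parB C37 C38 hE
  have hU1 : ∀ (ν : Fin (d + 1)) (s : Site (B6GlobalChartV1.PV d ℓ x.m x.K hd hL) 0),
      ‖((U ν s : 𝔸ˣ) : 𝔸)‖ ≤ 1 ∧ ‖(((U ν s)⁻¹ : 𝔸ˣ) : 𝔸)‖ ≤ 1 := fun ν s => norm_le_one_and_inv_of_mem G hG1 (hUG ν s)
  have hco : coordC G x.toKIdx (.base U) = UboxY x.toKIdx U := coordC_base_eq G x hUG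
  have hη : ((((geo9Y x).eta : ℂ)))⁻¹ = ((|x.toKIdx.cf| : ℝ) : ℂ) := eta_inv_eq_abs_cf x.toKIdx
  have hGb := GbC_eq_conj_bondOpCoordsRY x parS parB b (.base U)
  rw [decY_base] at hGb
  have hMS : 0 ≤ M₂ * ∑ j, ‖b j‖ := mul_nonneg hM₂ (Finset.sum_nonneg fun j _ => norm_nonneg _)
  have hlen : ∀ a : (geo9Y x).Site, 0 ≤ (geo9Y x).len a := fun a => (B9GeoLemma21KLevelV1.geo9Y_len_pos x a).le
  constructor
  · intro ν
    have h := hasMajorant_conj_cdsB_O_of_eBlockB (Rr := Rr) (Hp := Hp) (B := bg9Y 𝔸 G x) (U₁ := U) x.toKIdx b (fun U => U)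
      (GAY x.toKIdx parS parB (GpY x.toKIdx parS)) parB hEB hB₀ ιB hι hM₂ hrepr hU1 hdM ν
    refine hasMajorant_mono _ (hasMajorant_of_eq x.toKIdx (by rw [hco, hη, hGb]) (hasMajorant_diffLetter_inr_mul x.toKIdx b ιB U ν _ h))
      fun a a' => ?_
    have hw : 0 ≤ B₀ * (geo9Y x).len a * Real.exp (-(δ * (geo9Y x).dist a a')) := mul_nonneg (mul_nonneg hB₀ (hlen a)) (Real.exp_pos _).le
    show M₂ * (∑ j, ‖b j‖) * ((((ℓ + 1 : ℕ) : ℝ) * Real.exp (|δ| * (2 * ((d : ℝ) + 1))) * B₀) * (geo9Y x).len a *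
        Real.exp (-(δ * (geo9Y x).dist a a'))) ≤ cXY (d := d) (ℓ := ℓ) b M₂ mN δ * B₀ * (geo9Y x).len a * Real.exp (-(δ * (geo9Y x).dist a a'))
    unfold cXY
    have h1 : (((ℓ + 1 : ℕ) : ℝ)) ≤ (((ℓ + 1 : ℕ) : ℝ)) + (mN : ℝ) * (M₂ * ∑ j, ‖b j‖) := le_add_of_nonneg_right (by positivity)
    have h2 : 0 ≤ M₂ * (∑ j, ‖b j‖) * Real.exp (|δ| * (2 * ((d : ℝ) + 1))) * (B₀ * (geo9Y x).len a * Real.exp (-(δ * (geo9Y x).dist a a'))) :=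
      mul_nonneg (mul_nonneg hMS (Real.exp_pos _).le) hw
    nlinarith
  · intro ν
    have h := hasMajorant_conj_O_cdB_of_eBlockB (Rr := Rr) (Hp := Hp) (B := bg9Y 𝔸 G x) (U₁ := U) x.toKIdx b (fun U => U)
      (GAY x.toKIdx parS parB (GpY x.toKIdx parS)) parB hEB hB₀ ιB hι hM₂ hrepr hU1 hnbr ν
    refine hasMajorant_mono _ (hasMajorant_of_eq x.toKIdx (by rw [hco, hη, hGb]) (hasMajorant_mul_diffLetter_inl x.toKIdx b ιB U ν _ h))
      fun a a' => ?_
    show M₂ * (∑ j, ‖b j‖) * ((((mN : ℝ) * (M₂ * ∑ j, ‖b j‖) * Real.exp (|δ| * (2 * ((d : ℝ) + 1)))) * B₀) * (geo9Y x).len a *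
        Real.exp (-(δ * (geo9Y x).dist a a'))) ≤ cXY (d := d) (ℓ := ℓ) b M₂ mN δ * B₀ * (geo9Y x).len a * Real.exp (-(δ * (geo9Y x).dist a a'))
    unfold cXY
    have h1 : (mN : ℝ) * (M₂ * ∑ j, ‖b j‖) ≤ (((ℓ + 1 : ℕ) : ℝ)) + (mN : ℝ) * (M₂ * ∑ j, ‖b j‖) := le_add_of_nonneg_left (by positivity)
    have hw : 0 ≤ B₀ * (geo9Y x).len a * Real.exp (-(δ * (geo9Y x).dist a a')) := mul_nonneg (mul_nonneg hB₀ (hlen a)) (Real.exp_pos _).le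
    have h2 : 0 ≤ M₂ * (∑ j, ‖b j‖) * Real.exp (|δ| * (2 * ((d : ℝ) + 1))) * (B₀ * (geo9Y x).len a * Real.exp (-(δ * (geo9Y x).dist a a'))) :=
      mul_nonneg (mul_nonneg hMS (Real.exp_pos _).le) hw
    nlinarith

omit [Fintype (geo9Y x).Site] in
/-- ★ FIELD `reg_ginv` AT ONE MEMBER, field-shaped: at a `G`-valued base where `Δ_a(U)` is a unit, the frame's word (coordinates `coordC`, constant `η⁻¹`)
times `GbC` is `1` on both sides. [cite: Balaban1985BackgroundPropagators, (3.27) p.395, Thm 3.3 p.399] -/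
theorem reg_ginv_base (U : CfgY 𝔸 x.toKIdx) (hUG : GVal G x.toKIdx U) (hunit : IsUnit (deltaAY x.toKIdx parS parB (GpY x.toKIdx parS) U)) :
    deltaA (conj b (lapDDLetter (shiftY x.toKIdx) ((((geo9Y x).eta : ℂ))⁻¹) (coordC G x.toKIdx (.base U))))
        (conj b (dPrimeLetter (shiftY x.toKIdx) (coordC G x.toKIdx (.base U)) (geo9Y x).eta))
        (conjHom b (gradLin (shiftY x.toKIdx) ((((geo9Y x).eta : ℂ))⁻¹) (coordC G x.toKIdx (.base U))) ∘ₗ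
            (1 - (GopC x.toKIdx parS b (.base U) ∘ₗ QcsC x.toKIdx parS b (.base U) ∘ₗ CopC x.toKIdx parS b (.base U) ∘ₗ QcC x.toKIdx parS b (.base U) ∘ₗ
              GopC x.toKIdx parS b (.base U))) ∘ₗ
          conjHom b (divLin (shiftY x.toKIdx) ((((geo9Y x).eta : ℂ))⁻¹) (coordC G x.toKIdx (.base U))))
        (QsbC x.toKIdx parB b (.base U)) (abC x.toKIdx b) (QbC x.toKIdx parB b (.base U)) * GbC x.toKIdx parS parB b (.base U) = 1 ∧
    GbC x.toKIdx parS parB b (.base U) *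
      deltaA (conj b (lapDDLetter (shiftY x.toKIdx) ((((geo9Y x).eta : ℂ))⁻¹) (coordC G x.toKIdx (.base U))))
        (conj b (dPrimeLetter (shiftY x.toKIdx) (coordC G x.toKIdx (.base U)) (geo9Y x).eta))
        (conjHom b (gradLin (shiftY x.toKIdx) ((((geo9Y x).eta : ℂ))⁻¹) (coordC G x.toKIdx (.base U))) ∘ₗ
            (1 - (GopC x.toKIdx parS b (.base U) ∘ₗ QcsC x.toKIdx parS b (.base U) ∘ₗ CopC x.toKIdx parS b (.base U) ∘ₗ QcC x.toKIdx parS b (.base U) ∘ₗ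
              GopC x.toKIdx parS b (.base U))) ∘ₗ
          conjHom b (divLin (shiftY x.toKIdx) ((((geo9Y x).eta : ℂ))⁻¹) (coordC G x.toKIdx (.base U))))
        (QsbC x.toKIdx parB b (.base U)) (abC x.toKIdx b) (QbC x.toKIdx parB b (.base U)) = 1 := by
  have hη : ((((geo9Y x).eta : ℂ)))⁻¹ = ((|x.toKIdx.cf| : ℝ) : ℂ) := eta_inv_eq_abs_cf x.toKIdx
  rw [coordC_base_eq G x hUG, hη]
  have h := word_mul_GbC x.toKIdx parS parB b (.base U) (by rw [decY_base]; exact hunit)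
  rw [decY_base] at h
  exact h

omit [Fintype (geo9Y x).Site] in
/-- ★ FIELD `gb_eq_cplx` AT ONE MEMBER, field-shaped: at a (base `U`, multiplier `a`) pair with `U` `G`-valued, any two-sided inverse `X` of the frame's word
at the product field `prodCfg (coordC (base U)) η (expAC (base U) (mult a))` with the letters at `prod U a` IS `GbC (prod U a)`.
[cite: Balaban1985BackgroundPropagators, (3.27) p.395, (3.86) p.407] -/
theorem gb_eq_cplx_pair (U : CfgY 𝔸 x.toKIdx) (hUG : GVal G x.toKIdx U) (a : AfldY 𝔸 x.toKIdx) (X : Module.End ℝ ((Fin (d + 1) × SiteY x.toKIdx) × ι → ℝ))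
    (h1 : deltaA (conj b (lapDDLetter (shiftY x.toKIdx) ((((geo9Y x).eta : ℂ))⁻¹)
          (prodCfg (coordC G x.toKIdx (.base U)) (geo9Y x).eta (expAC x.toKIdx (.base U) (.mult a)))))
        (conj b (dPrimeLetter (shiftY x.toKIdx) (prodCfg (coordC G x.toKIdx (.base U)) (geo9Y x).eta (expAC x.toKIdx (.base U) (.mult a))) (geo9Y x).eta))
        (conjHom b (gradLin (shiftY x.toKIdx) ((((geo9Y x).eta : ℂ))⁻¹)
              (prodCfg (coordC G x.toKIdx (.base U)) (geo9Y x).eta (expAC x.toKIdx (.base U) (.mult a)))) ∘ₗ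
            (1 - (GopC x.toKIdx parS b (.prod U a) ∘ₗ QcsC x.toKIdx parS b (.prod U a) ∘ₗ CopC x.toKIdx parS b (.prod U a) ∘ₗ QcC x.toKIdx parS b (.prod U a) ∘ₗ
              GopC x.toKIdx parS b (.prod U a))) ∘ₗ
          conjHom b (divLin (shiftY x.toKIdx) ((((geo9Y x).eta : ℂ))⁻¹)
              (prodCfg (coordC G x.toKIdx (.base U)) (geo9Y x).eta (expAC x.toKIdx (.base U) (.mult a)))))
        (QsbC x.toKIdx parB b (.prod U a)) (abC x.toKIdx b) (QbC x.toKIdx parB b (.prod U a)) * X = 1)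
    (h2 : X * deltaA (conj b (lapDDLetter (shiftY x.toKIdx) ((((geo9Y x).eta : ℂ))⁻¹)
          (prodCfg (coordC G x.toKIdx (.base U)) (geo9Y x).eta (expAC x.toKIdx (.base U) (.mult a)))))
        (conj b (dPrimeLetter (shiftY x.toKIdx) (prodCfg (coordC G x.toKIdx (.base U)) (geo9Y x).eta (expAC x.toKIdx (.base U) (.mult a))) (geo9Y x).eta))
        (conjHom b (gradLin (shiftY x.toKIdx) ((((geo9Y x).eta : ℂ))⁻¹)
              (prodCfg (coordC G x.toKIdx (.base U)) (geo9Y x).eta (expAC x.toKIdx (.base U) (.mult a)))) ∘ₗ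
            (1 - (GopC x.toKIdx parS b (.prod U a) ∘ₗ QcsC x.toKIdx parS b (.prod U a) ∘ₗ CopC x.toKIdx parS b (.prod U a) ∘ₗ QcC x.toKIdx parS b (.prod U a) ∘ₗ
              GopC x.toKIdx parS b (.prod U a))) ∘ₗ
          conjHom b (divLin (shiftY x.toKIdx) ((((geo9Y x).eta : ℂ))⁻¹)
              (prodCfg (coordC G x.toKIdx (.base U)) (geo9Y x).eta (expAC x.toKIdx (.base U) (.mult a)))))
        (QsbC x.toKIdx parB b (.prod U a)) (abC x.toKIdx b) (QbC x.toKIdx parB b (.prod U a)) = 1) :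
    IsUnit (deltaAY x.toKIdx parS parB (GpY x.toKIdx parS) (decY x.toKIdx (.prod U a))) ∧ GbC x.toKIdx parS parB b (.prod U a) = X := by
  have hη : ((((geo9Y x).eta : ℂ)))⁻¹ = ((|x.toKIdx.cf| : ℝ) : ℂ) := eta_inv_eq_abs_cf x.toKIdx
  rw [coordC_base_eq G x hUG, hη] at h1 h2
  exact GbC_eq_of_two_sided x.toKIdx parS parB b (.prod U a) X h1 h2

end Prep

/-! ## §2 ★★★ The instance over the coded carriers of a subfamily -/

section Instance

variable [NormOneClass 𝔸] [FiniteDimensional ℝ 𝔸] {J : Type} (f : J → MemberY d ℓ hd hL b₀ b₁ Mstar)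
  [∀ x : MemberY d ℓ hd hL b₀ b₁ Mstar, Fintype (geo9Y x).Site]
  [instDS : ∀ x : MemberY d ℓ hd hL b₀ b₁ Mstar, DecidableEq (geo9Y x).Site] [instNE : ∀ x : MemberY d ℓ hd hL b₀ b₁ Mstar, Nonempty (geo9Y x).Site]
  (c35 : ℝ) (G : Subgroup 𝔸ˣ) (par : ∀ j : J, SiteParY 𝔸 (f j).toKIdx) (parB : ∀ j : J, BondParY 𝔸 (f j).toKIdx)
  {ι : Type} [Fintype ι] [DecidableEq ι] (b : Module.Basis ι ℝ 𝔸) (ιB : ∀ j : J, BlkY (f j).toKIdx → IBondY (f j).toKIdx)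
  (C37 C38 : ∀ j : J, ℝ → CfgY 𝔸 (f j).toKIdx → AfldY 𝔸 (f j).toKIdx → Prop)

/-- ★★★ **THE G FRAME OF ROW 13 AT NODE 00's LETTERS**: `GFrame₅` over the coded carriers of the subfamily `f`, site family `KSC` (G′), bond family
`KACU G (f j) (GAY … (par j) (parB j) (GpY (par j))) (parB j) (C37 j) (C38 j)` (G), C⁻¹ kernel `pullS … (CinvY f G par j)`; parent gen 12's `cinvFrame₃CodedOn`;
letters and laws of `B9SectBGWordDeltaAY` ∕ `B9SectBQSizesY` ∕ `B9SectBGClassLettersY` ∕ `B9SectBGReadCodedY`; displayed: the parent's binders and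
`hunitA`, `hparB`, `hb₁`, `hreg335P`, `hC37G`, `hvarB`, `hMd`, `hnbr`. [cite: Balaban1985BackgroundPropagators, Thm 3.4 p.400, Thm 3.3 p.399, (3.15) p.393, (3.24)–(3.27) pp.394–395, (3.35)–(3.37) p.396, (3.42) p.397, (3.80)–(3.86) p.407; Balaban1984PropagatorsII, (2.51) p.232, Lemma 2.1 p.234] -/
noncomputable def gFrame₅CodedOn (hι : ∀ (j : J) (s : BlkY (f j).toKIdx), β (f j).toKIdx.hN (f j).toKIdx.D (f j).toKIdx.hk (ιB j s) = s)
    (hG1 : ∀ u : 𝔸ˣ, u ∈ G → ‖(u : 𝔸)‖ ≤ 1) (hpar : ∀ j (U : CfgY 𝔸 (f j).toKIdx), GVal G (f j).toKIdx U → ∀ z w, par j U z w ∈ G)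
    (hunit : ∀ j (U : CfgY 𝔸 (f j).toKIdx), GVal G (f j).toKIdx U → IsUnit (deltaPrimeAY (f j).toKIdx (par j) U))
    (M₂ : ℝ) (hM₂ : 0 ≤ M₂) (hrepr : ∀ (v : 𝔸) (j : ι), |b.repr v j| ≤ M₂ * ‖v‖) (hcR : 0 < M₂ * ∑ j, ‖b j‖)
    (Cq : ℝ) (hCq : 0 ≤ Cq) (hC37 : ∀ j β' U a, C37 j β' U a → GVal G (f j).toKIdx U ∧ CplxLettersY G (f j) (par j) (ιB j) Cq β' U a)
    (MInv aInv aW : ℝ) (hMInv : 0 < MInv) (haInv : 0 < aInv) (haW : 0 < aW)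
    (hunitX : ∀ j (U : CfgY 𝔸 (f j).toKIdx), GVal G (f j).toKIdx U → IsUnit (XY (f j).toKIdx (par j) (GpY (f j).toKIdx (par j)) U))
    (hsym : ∀ j (U : CfgY 𝔸 (f j).toKIdx) (z w : SiteY (f j).toKIdx), par j U z w = (par j U w z)⁻¹)
    -- the G-side displayed laws
    (hunitA : ∀ j (U : CfgY 𝔸 (f j).toKIdx), GVal G (f j).toKIdx U → IsUnit (deltaAY (f j).toKIdx (par j) (parB j) (GpY (f j).toKIdx (par j)) U))
    (hparB : ∀ j (U : CfgY 𝔸 (f j).toKIdx), GVal G (f j).toKIdx U → ∀ y f', parB j U y f' ∈ G) (hb₁ : 0 ≤ b₁)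
    (C₀ : ℝ) (hC₀ : 0 ≤ C₀)
    (hreg335P : ∀ j (α₀ : ℝ) (U : CfgY 𝔸 (f j).toKIdx), MInv ≤ (geo9Y (f j)).M → 0 < α₀ → (geo9Y (f j)).M * α₀ ≤ aInv →
      (bg9Y 𝔸 G (f j)).Reg335 c35 α₀ U → Reg335PlaqY G (f j) (ιB j) C₀ U)
    (hC37G : ∀ j β' U a, C37 j β' U a → CplxLettersGY G (f j) (ιB j) β' U a)
    (cVar : ℝ) (hcVar : 0 ≤ cVar) (hvarB : ∀ j β' U a, C37 j β' U a → VarParBY (f j).toKIdx (parB j) cVar β' U a)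
    (hMd : 2 * ((d : ℝ) + 1) < MInv) (mN : ℕ) (hnbr : ∀ (j : J) (y' : IBondY (f j).toKIdx), (nbr (geo9Y (f j)) (2 * ((d : ℝ) + 1)) y').card ≤ mN) :
    GFrame₅ c35 (fun j => geo9Y (f j)) (fun j => (codingYx G (f j) (C37 j) (C38 j)).bg) (fun j => KSC G (f j) (par j) (C37 j) (C38 j)) b (Fin (d + 1))
      (fun j => SiteY (f j).toKIdx) (fun j => BlkY (f j).toKIdx × ι)
      (fun j => KACU G (f j) (GAY (f j).toKIdx (par j) (parB j) (GpY (f j).toKIdx (par j))) (parB j) (C37 j) (C38 j))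
      (fun j => pullS (codingYx G (f j) (C37 j) (C38 j)) (CinvY f G par j)) :=
  { cinvFrame₃CodedOn f c35 G par b ιB C37 C38 hι hG1 hpar hunit M₂ hM₂ hrepr hcR Cq hCq hC37 MInv aInv aW hMInv haInv haW hunitX hsym with
    C₀ := C₀
    κQb := (M₂ * ∑ j, ‖b j‖) * (2 * (((ℓ + 1 : ℕ) : ℝ)) ^ (d + 1)) * Real.exp (1 * ((ℓ : ℝ) + 3))
    cFb := (M₂ * ∑ j, ‖b j‖) * (cVar * (2 * (((ℓ + 1 : ℕ) : ℝ)) ^ (d + 1))) * Real.exp (1 * ((ℓ : ℝ) + 3))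
    abar := (M₂ * ∑ j, ‖b j‖) * b₁
    cRG := fun δ => M₂ * (∑ j, ‖b j‖) + cXY (d := d) (ℓ := ℓ) b M₂ mN δ
    wBG := fun B _ => (M₂ * ∑ j, ‖b j‖) * B + 1
    wδG := fun δ => δ
    C₀_nonneg := hC₀
    κQb_nonneg := by positivity
    cFb_nonneg := by positivity
    abar_nonneg := mul_nonneg hcR.le hb₁
    cRG_pos := fun δ hδ => add_pos_of_pos_of_nonneg hcR (cXY_nonneg (d := d) (ℓ := ℓ) b hM₂ mN δ)
    wBG_pos := fun B _ hB _ => by positivity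
    wδG_pos := fun δ hδ => hδ
    rep := fun j => repY (f j).toKIdx ι
    Gb := fun j c => GbC (f j).toKIdx (par j) (parB j) b c
    Qb := fun j c => QbC (f j).toKIdx (parB j) b c
    Qsb := fun j c => QsbC (f j).toKIdx (parB j) b c
    ab := fun j => abC (f j).toKIdx b
    F₂ := fun j c c' => F₂C (f j).toKIdx (parB j) b c c'
    F₂s := fun j c c' => F₂sC (f j).toKIdx (parB j) b c c'
    LapB := fun j c => LapBC (f j).toKIdx b c
    L_one_le := fun j => geo9K_one_le_L (f j).toKIdx
    T_comm := fun j μ ν z => shiftY_shiftY_comm (f j).toKIdx μ ν z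
    hrep := fun j q => blkC_repY (f j).toKIdx ι (ιB j) q
    hinj := fun j => repY_injective (f j).toKIdx ι
    stencilFB := fun j μ ν z => stencilFB_blkC (f j).toKIdx (ιB j) (hι j) μ ν z
    stencilSt := fun j μ z q hq => stencilSt_blkC (f j).toKIdx (ιB j) (hι j) μ z q hq
    stencilLoc := fun j μ z q hq => stencilLoc_blkC (f j).toKIdx (ιB j) (hι j) μ z q hq
    reg335 := fun j α₀ c hM hα₀ hMa hreg => by
      obtain ⟨U, rfl, hU⟩ := (codingYx G (f j) (C37 j) (C38 j)).exists_of_bg_Reg335 hreg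
      exact hreg335P j α₀ U hM hα₀ hMa hU
    hQb := fun j α₀ c δ hM hα₀ hMa hreg hδ hδ1 => by
      letI : Fintype (geo9K (f j).toKIdx).Site := ‹∀ x : MemberY d ℓ hd hL b₀ b₁ Mstar, Fintype (geo9Y x).Site› (f j)
      obtain ⟨U, rfl, hU⟩ := (codingYx G (f j) (C37 j) (C38 j)).exists_of_bg_Reg335 hreg
      have h := hasMajorant_QbC (Rr := 0) (Hp := True) (f j).toKIdx (parB j) b (ιB j) (hι j) hM₂ hrepr
        (parB_contractive G (f j) (parB j) hG1 (hparB j U hU.1.1)) hδ.le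
      refine hasMajorant_mono _ h fun a a' => ?_
      have hL1 : (1 : ℝ) ≤ 2 * (((ℓ + 1 : ℕ) : ℝ)) ^ (d + 1) := by
        have : (1 : ℝ) ≤ (((ℓ + 1 : ℕ) : ℝ)) ^ (d + 1) := one_le_pow₀ (by exact_mod_cast Nat.succ_le_succ (Nat.zero_le ℓ))
        linarith
      have hδ1' : δ ≤ 1 := hδ1
      have hℓ : (0 : ℝ) ≤ (ℓ : ℝ) + 3 := by positivity
      have he : Real.exp (δ * ((ℓ : ℝ) + 3)) ≤ Real.exp (1 * ((ℓ : ℝ) + 3)) := Real.exp_le_exp.2 (by nlinarith)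
      have hE0 := (Real.exp_pos (-(δ * (geo9K (f j).toKIdx).dist a a'))).le
      have hMS : 0 ≤ M₂ * ∑ j, ‖b j‖ := hcR.le
      calc M₂ * (∑ j, ‖b j‖) * (Real.exp (δ * ((ℓ : ℝ) + 3)) * Real.exp (-(δ * (geo9K (f j).toKIdx).dist a a')))
          = M₂ * (∑ j, ‖b j‖) * 1 * Real.exp (δ * ((ℓ : ℝ) + 3)) * Real.exp (-(δ * (geo9K (f j).toKIdx).dist a a')) := by ring
        _ ≤ M₂ * (∑ j, ‖b j‖) * (2 * (((ℓ + 1 : ℕ) : ℝ)) ^ (d + 1)) * Real.exp (1 * ((ℓ : ℝ) + 3)) *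
              Real.exp (-(δ * (geo9K (f j).toKIdx).dist a a')) := by gcongr
    hQsb := fun j α₀ c δ hM hα₀ hMa hreg hδ hδ1 => by
      letI : Fintype (geo9K (f j).toKIdx).Site := ‹∀ x : MemberY d ℓ hd hL b₀ b₁ Mstar, Fintype (geo9Y x).Site› (f j)
      obtain ⟨U, rfl, hU⟩ := (codingYx G (f j) (C37 j) (C38 j)).exists_of_bg_Reg335 hreg
      have h := hasMajorant_QsbC (Rr := 0) (Hp := True) (f j).toKIdx (parB j) b (ιB j) (hι j) hM₂ hrepr
        (parB_contractive G (f j) (parB j) hG1 (hparB j U hU.1.1)) hδ.le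
      refine hasMajorant_mono _ h fun a a' => ?_
      have hδ1' : δ ≤ 1 := hδ1
      have hℓ : (0 : ℝ) ≤ (ℓ : ℝ) + 3 := by positivity
      have he : Real.exp (δ * ((ℓ : ℝ) + 3)) ≤ Real.exp (1 * ((ℓ : ℝ) + 3)) := Real.exp_le_exp.2 (by nlinarith)
      have hMS : 0 ≤ M₂ * ∑ j, ‖b j‖ := hcR.le
      calc M₂ * (∑ j, ‖b j‖) * (2 * (((ℓ + 1 : ℕ) : ℝ)) ^ (d + 1) * Real.exp (δ * ((ℓ : ℝ) + 3)) * Real.exp (-(δ * (geo9K (f j).toKIdx).dist a a')))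
          = M₂ * (∑ j, ‖b j‖) * (2 * (((ℓ + 1 : ℕ) : ℝ)) ^ (d + 1)) * Real.exp (δ * ((ℓ : ℝ) + 3)) * Real.exp (-(δ * (geo9K (f j).toKIdx).dist a a')) := by
            ring
        _ ≤ M₂ * (∑ j, ‖b j‖) * (2 * (((ℓ + 1 : ℕ) : ℝ)) ^ (d + 1)) * Real.exp (1 * ((ℓ : ℝ) + 3)) *
              Real.exp (-(δ * (geo9K (f j).toKIdx).dist a a')) := by gcongr
    ha324 := fun j => by
      letI : Fintype (geo9K (f j).toKIdx).Site := ‹∀ x : MemberY d ℓ hd hL b₀ b₁ Mstar, Fintype (geo9Y x).Site› (f j)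
      refine hasMajorant_mono _ (hasMajorant_abC (Rr := 0) (Hp := True) (f j).toKIdx b (ιB j) (hι j) hM₂ hrepr hb₁) fun a a' => ?_
      split_ifs <;> first | exact le_of_eq (mul_assoc _ _ _).symm | exact le_of_eq (mul_zero _) | simp_all
    reg_ginv := fun j α₀ c hM hα₀ hMa hreg => by
      obtain ⟨U, rfl, hU⟩ := (codingYx G (f j) (C37 j) (C38 j)).exists_of_bg_Reg335 hreg
      exact reg_ginv_base G (f j) (par j) (parB j) b U hU.1.1 (hunitA j U hU.1.1)
    gb_eq_cplx := fun j α₁ c c' X hα₁ h37 h1 h2 => by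
      obtain ⟨U, a, rfl, rfl, hC⟩ := (codingYx G (f j) (C37 j) (C38 j)).exists_of_bg_Cplx337 h37
      exact (gb_eq_cplx_pair G (f j) (par j) (parB j) b U (hC37 j α₁ U a hC).1 a X h1 h2).2
    qb_mul := fun j α₁ c c' hα₁ h37 => by
      obtain ⟨U, a, rfl, rfl, hC⟩ := (codingYx G (f j) (C37 j) (C38 j)).exists_of_bg_Cplx337 h37
      exact ⟨qbC_prod (f j).toKIdx (parB j) b U a, qsbC_prod (f j).toKIdx (parB j) b U a⟩
    hF₂ := fun j α₁ c c' hα₁ h37 δ hδ hδ1 => by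
      letI : Fintype (geo9K (f j).toKIdx).Site := ‹∀ x : MemberY d ℓ hd hL b₀ b₁ Mstar, Fintype (geo9Y x).Site› (f j)
      obtain ⟨U, a, rfl, rfl, hC⟩ := (codingYx G (f j) (C37 j) (C38 j)).exists_of_bg_Cplx337 h37
      have hcv : 0 ≤ cVar * α₁ := mul_nonneg hcVar hα₁.le
      have hv := hvarB j α₁ U a hC
      have hδ1' : δ ≤ 1 := hδ1
      have hℓ : (0 : ℝ) ≤ (ℓ : ℝ) + 3 := by positivity
      have he : Real.exp (δ * ((ℓ : ℝ) + 3)) ≤ Real.exp (1 * ((ℓ : ℝ) + 3)) := Real.exp_le_exp.2 (by nlinarith)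
      have hL1 : (1 : ℝ) ≤ 2 * (((ℓ + 1 : ℕ) : ℝ)) ^ (d + 1) := by
        have : (1 : ℝ) ≤ (((ℓ + 1 : ℕ) : ℝ)) ^ (d + 1) := one_le_pow₀ (by exact_mod_cast Nat.succ_le_succ (Nat.zero_le ℓ))
        linarith
      have hMS : 0 ≤ M₂ * ∑ j, ‖b j‖ := hcR.le
      constructor
      · refine hasMajorant_mono _ (hasMajorant_F₂C (Rr := 0) (Hp := True) (f j).toKIdx (parB j) b (ιB j) (hι j) hM₂ hrepr hcv hv hδ.le) fun a a' => ?_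
        calc M₂ * (∑ j, ‖b j‖) * (cVar * α₁ * Real.exp (δ * ((ℓ : ℝ) + 3)) * Real.exp (-(δ * (geo9K (f j).toKIdx).dist a a')))
            = M₂ * (∑ j, ‖b j‖) * (cVar * 1) * Real.exp (δ * ((ℓ : ℝ) + 3)) * α₁ * Real.exp (-(δ * (geo9K (f j).toKIdx).dist a a')) := by ring
          _ ≤ M₂ * (∑ j, ‖b j‖) * (cVar * (2 * (((ℓ + 1 : ℕ) : ℝ)) ^ (d + 1))) * Real.exp (1 * ((ℓ : ℝ) + 3)) * α₁ *
                Real.exp (-(δ * (geo9K (f j).toKIdx).dist a a')) := by gcongr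
      · refine hasMajorant_mono _ (hasMajorant_F₂sC (Rr := 0) (Hp := True) (f j).toKIdx (parB j) b (ιB j) (hι j) hM₂ hrepr hcv hv hδ.le) fun a a' => ?_
        calc M₂ * (∑ j, ‖b j‖) * (cVar * α₁ * (2 * (((ℓ + 1 : ℕ) : ℝ)) ^ (d + 1)) * Real.exp (δ * ((ℓ : ℝ) + 3)) *
              Real.exp (-(δ * (geo9K (f j).toKIdx).dist a a')))
            = M₂ * (∑ j, ‖b j‖) * (cVar * (2 * (((ℓ + 1 : ℕ) : ℝ)) ^ (d + 1))) * Real.exp (δ * ((ℓ : ℝ) + 3)) * α₁ *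
                Real.exp (-(δ * (geo9K (f j).toKIdx).dist a a')) := by ring
          _ ≤ M₂ * (∑ j, ‖b j‖) * (cVar * (2 * (((ℓ + 1 : ℕ) : ℝ)) ^ (d + 1))) * Real.exp (1 * ((ℓ : ℝ) + 3)) * α₁ *
                Real.exp (-(δ * (geo9K (f j).toKIdx).dist a a')) := by gcongr
    cplxG := fun j α₁ c c' hα₁ h37 => by
      obtain ⟨U, a, rfl, rfl, hC⟩ := (codingYx G (f j) (C37 j) (C38 j)).exists_of_bg_Cplx337 h37
      exact hC37G j α₁ U a hC
    readG342 := fun j α₀ c B₀ δ hM hα₀ hMa hreg hB₀ hδ hE => by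
      obtain ⟨U, rfl, hU⟩ := (codingYx G (f j) (C37 j) (C38 j)).exists_of_bg_Reg335 hreg
      exact readG342_base G (f j) (par j) (parB j) b (ιB j) (C37 j) (C38 j) (hι j) hM₂ hrepr (fun δ _ => cXY_nonneg (d := d) (ℓ := ℓ) b hM₂ mN δ)
        (crossReadY_KACU G (f j) (par j) (parB j) b (ιB j) (C37 j) (C38 j) (hι j) hG1 hM₂ hrepr (hnbr j)) (lt_of_lt_of_le hMd hM) U hU.1.1 hB₀ hδ hE
    writeG342 := fun j c c' α₁ B δ hα₁ hα₁W h37 hB hδ h0 h1 h2 h3 => by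
      obtain ⟨U, a, rfl, rfl, hC⟩ := (codingYx G (f j) (C37 j) (C38 j)).exists_of_bg_Cplx337 h37
      have hw := writeG342_GbC (Rr := 0) (Hp := True) G (f j) (par j) (parB j) b (ιB j) (C37 j) (C38 j) (hι j) hM₂ hrepr U (hC37 j α₁ U a hC).1 a hB h0
        (fun ν => h1 (Sum.inl ν)) (fun ν => h2 (Sum.inr ν)) h3
      exact eBlock_mono (f j).toKIdx _ (by linarith) hw }

/-! ## §3 ★★ The (3.42) step of the bond family through the frame -/

/-- ★★ **`StepEPos` OF THE CODED BOND FAMILY `KACU` THROUGH THE G FRAME** (r06's `stepEPos_of_gFrame₅` on `gFrame₅CodedOn`), GIVEN the Lemma-2.1 datum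
`(d261, h261)` of the frame.  (Route F landed the same step under the displayed (3.85) pair; this is Route L's, under the displayed laws of the instance.)
[cite: Balaban1985BackgroundPropagators, Thm 3.4 p.400 + Thm 3.3 p.399 + (3.42) p.397 + (3.82)–(3.86) p.407; Balaban1984PropagatorsII, Lemma 2.1 p.234, (2.51) p.232] -/
theorem stepEPos_KACU_frame_on (hι : ∀ (j : J) (s : BlkY (f j).toKIdx), β (f j).toKIdx.hN (f j).toKIdx.D (f j).toKIdx.hk (ιB j s) = s)
    (hG1 : ∀ u : 𝔸ˣ, u ∈ G → ‖(u : 𝔸)‖ ≤ 1) (hpar : ∀ j (U : CfgY 𝔸 (f j).toKIdx), GVal G (f j).toKIdx U → ∀ z w, par j U z w ∈ G)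
    (hunit : ∀ j (U : CfgY 𝔸 (f j).toKIdx), GVal G (f j).toKIdx U → IsUnit (deltaPrimeAY (f j).toKIdx (par j) U))
    (M₂ : ℝ) (hM₂ : 0 ≤ M₂) (hrepr : ∀ (v : 𝔸) (j : ι), |b.repr v j| ≤ M₂ * ‖v‖) (hcR : 0 < M₂ * ∑ j, ‖b j‖)
    (Cq : ℝ) (hCq : 0 ≤ Cq) (hC37 : ∀ j β' U a, C37 j β' U a → GVal G (f j).toKIdx U ∧ CplxLettersY G (f j) (par j) (ιB j) Cq β' U a)
    (MInv aInv aW : ℝ) (hMInv : 0 < MInv) (haInv : 0 < aInv) (haW : 0 < aW)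
    (hunitX : ∀ j (U : CfgY 𝔸 (f j).toKIdx), GVal G (f j).toKIdx U → IsUnit (XY (f j).toKIdx (par j) (GpY (f j).toKIdx (par j)) U))
    (hsym : ∀ j (U : CfgY 𝔸 (f j).toKIdx) (z w : SiteY (f j).toKIdx), par j U z w = (par j U w z)⁻¹)
    (hunitA : ∀ j (U : CfgY 𝔸 (f j).toKIdx), GVal G (f j).toKIdx U → IsUnit (deltaAY (f j).toKIdx (par j) (parB j) (GpY (f j).toKIdx (par j)) U))
    (hparB : ∀ j (U : CfgY 𝔸 (f j).toKIdx), GVal G (f j).toKIdx U → ∀ y f', parB j U y f' ∈ G) (hb₁ : 0 ≤ b₁)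
    (C₀ : ℝ) (hC₀ : 0 ≤ C₀)
    (hreg335P : ∀ j (α₀ : ℝ) (U : CfgY 𝔸 (f j).toKIdx), MInv ≤ (geo9Y (f j)).M → 0 < α₀ → (geo9Y (f j)).M * α₀ ≤ aInv →
      (bg9Y 𝔸 G (f j)).Reg335 c35 α₀ U → Reg335PlaqY G (f j) (ιB j) C₀ U)
    (hC37G : ∀ j β' U a, C37 j β' U a → CplxLettersGY G (f j) (ιB j) β' U a)
    (cVar : ℝ) (hcVar : 0 ≤ cVar) (hvarB : ∀ j β' U a, C37 j β' U a → VarParBY (f j).toKIdx (parB j) cVar β' U a)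
    (hMd : 2 * ((d : ℝ) + 1) < MInv) (mN : ℕ) (hnbr : ∀ (j : J) (y' : IBondY (f j).toKIdx), (nbr (geo9Y (f j)) (2 * ((d : ℝ) + 1)) y').card ≤ mN)
    (d261 : ℝ → ℕ)
    (h261 : ∀ (j : J) (δ α : ℝ), 0 < δ → δ ≤ 1 → 9 / 5000 ≤ α → α < 1 →
      (gFrame₅CodedOn f c35 G par parB b ιB C37 C38 hι hG1 hpar hunit M₂ hM₂ hrepr hcR Cq hCq hC37 MInv aInv aW hMInv haInv haW hunitX hsym hunitA hparB hb₁ C₀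
        hC₀ hreg335P hC37G cVar hcVar hvarB hMd mN hnbr).M261 δ ≤ (geo9Y (f j)).M →
      Ineq261 (d261 δ) (toB6 (geo9Y (f j)) 0 True) δ α) :
    StepEPos (d + 1) c35 (fun j => geo9Y (f j)) (fun j => (codingYx G (f j) (C37 j) (C38 j)).bg) (fun j => KSC G (f j) (par j) (C37 j) (C38 j))
      (fun j => KACU G (f j) (GAY (f j).toKIdx (par j) (parB j) (GpY (f j).toKIdx (par j))) (parB j) (C37 j) (C38 j))
      (fun j => pullS (codingYx G (f j) (C37 j) (C38 j)) (CinvY f G par j))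
      (fun j => KACU G (f j) (GAY (f j).toKIdx (par j) (parB j) (GpY (f j).toKIdx (par j))) (parB j) (C37 j) (C38 j)) :=
  stepEPos_of_gFrame₅ (F := gFrame₅CodedOn f c35 G par parB b ιB C37 C38 hι hG1 hpar hunit M₂ hM₂ hrepr hcR Cq hCq hC37 MInv aInv aW hMInv haInv haW hunitX
    hsym hunitA hparB hb₁ C₀ hC₀ hreg335P hC37G cVar hcVar hvarB hMd mN hnbr) d261 h261

end Instance

end Literature.MathematicalPhysics.QuantumFieldTheory.Balaban1983to89.B9SectBGFrameCodedY

end
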